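import Literature.MathematicalPhysics.QuantumManyBody.PeriodicBoseGasPairingMomentum
import Literature.MathematicalPhysics.QuantumManyBody.PeriodicBoseGasEq242
import Literature.MathematicalPhysics.QuantumManyBody.PeriodicBoseGasBounded
import Literature.Analysis.FunctionSpaces.MollificationLp
import Mathlib.Analysis.Calculus.BumpFunction.Convolution
import Mathlib.Analysis.Fourier.Convolution
import HarnessLib

/-!
# Fournais 2020, (2.29) proved on bounded states: `⟨Φ, A₂Φ⟩ = ∫ Ŵ₁(p) Re⟨b_p†Φ, b_{-p}Φ⟩ dp`

Topic `Literature/MathematicalPhysics/QuantumManyBody` (provefact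
`Literature.MathematicalPhysics.QuantumManyBody.BoseGas.Fournais2020_condensation`). This file discharges
`Fournais2020_eq229_bdd` (`PeriodicBoseGasBounded.lean`), the pairing identity [Fournais2020, (2.29)]
("a direct calculation gives `A₂ = ½(2π)⁻³∫Ŵ₁(k)(b_k†b_{-k}† + b_kb_{-k})dk`") for bounded measurable
states `Φ` on `Λ(u)ⁿ` of finite kinetic form, with the absolute convergence of the momentum integral:
`theorem Fournais2020_eq229_bdd_holds : Fournais2020_eq229_bdd`. Steps (I is
`PeriodicBoseGasPairingMomentum.lean`):

* (II) `integral_fourier_mul_pairing` — for a real, even, continuous, integrable `f` with integrable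
  transform, `∫ 𝓕f(p)⟨b_p†Φ, b_{-p}Φ⟩dp = ∑_{i≠j}∫conj(PᵢPⱼΦ)χ_Λ(xᵢ)f(xᵢ-xⱼ)χ_Λ(xⱼ)QⱼQᵢΦ dX` (Fubini in
  `(p, X)`, the integrand being `O(|𝓕f(p)|·|PᵢPⱼΦ||QⱼQᵢΦ|)`, and Fourier inversion
  `∫𝓕f(p)conj(φ_p(x))φ_p(y)dp = χ_Λ(x)χ_Λ(y)f(y-x)`);
* (IIIa) the position side `f ↦ ⟨Φ, A₂[f]Φ⟩` is `L¹`-Lipschitz for bounded `Φ`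
  (`norm_pairTerm_sub_le`: `|T(f) - T(g)| ≤ 4M²sup χ² ℓ^{3(n-1)}‖f - g‖₁`) and `a2Form` is its real part
  at `W₁` (`a2Form_eq_re_sum`);
* (IIIb) mollification `f_k = ψ_k ⋆ W₁` by normalised bumps: `f_k` is continuous, integrable, even,
  `𝓕f_k = 𝓕ψ_k·𝓕W₁` is integrable (`ψ_k` is Schwartz), `|𝓕ψ_k| ≤ 1`, `𝓕ψ_k(p) → 1`
  (`normed_convolution_props`, `fourier_normed_props`, `tendsto_fourier_normed`), `𝓕W₁` is real
  (`im_fourier_ofReal_eq_zero`), and `‖f_k - W₁‖₁ → 0`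
  (`Literature.Analysis.FunctionSpaces.tendsto_eLpNorm_normed_convolution_sub_self`);
* (IIIc) the dominating function (`exists_integrable_bound_pairing`): `|Ŵ₁(p)||⟨b_p†Φ,b_{-p}Φ⟩| ≤
  |Ŵ₁|‖b_p†Φ‖‖b_{-p}Φ‖`, `sup_p‖b_p†Φ‖ < ∞`, `|Ŵ₁|‖b_{-p}Φ‖ ≤ ½(|Ŵ₁|²/(8π²p²) + 8π²p²‖b_{-p}Φ‖²)`, finite by
  the Coulomb bound (2.42) (`Fournais2020_eq242_holds`) and by (2.30), (2.32) with the finite kinetic form;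
* assembly by dominated convergence on the momentum side and `L¹`-continuity on the position side.

Boundedness of `Φ` enters only in (IIIa); for unbounded `Φ` of finite kinetic energy the same
continuity is the `-Δ`-form-boundedness of `W₁` (not in the tree), which is why the unrestricted
`Fournais2020_eq229` is left as a named fact. No new definitions.

## References

* [Fournais2020] S. Fournais, *Length scales for BEC in the dilute Bose gas*, arXiv:2011.00309,
  EMS Ser. Congr. Rep. 18 (2021), doi:10.4171/ecr/18-1/7: (2.24), (2.27)–(2.32), (2.42).
* [FournaisSolovej2020] S. Fournais, J. P. Solovej, *The energy of dilute Bose gases*,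
  Ann. of Math. 192 (2020) 893–976: §6.
-/

noncomputable section

open MeasureTheory Set
open scoped ENNReal NNReal FourierTransform ComplexConjugate RealInnerProductSpace

namespace Literature.MathematicalPhysics.QuantumManyBody.BoseGas


/-! ### Step II: the momentum integral against `𝓕F` for a nice even potential `F` -/

section FourierStep

variable {m : ℕ} {χ : Space → ℝ} {ℓ : ℝ} {u : Space}

/-- `(p, X) ↦ φ_p(xᵢ)` is jointly continuous. [cite: Fournais2020, (2.27)] -/
theorem continuous_locWave_eval (hχ : IsLocalizationFunction χ) (ℓ : ℝ) (u : Space) (i : Fin (m + 1)) :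
    Continuous fun r : Space × Config (m + 1) => locWave χ ℓ u r.1 (r.2 i) := by
  unfold locWave locFun
  have h1 : Continuous fun r : Space × Config (m + 1) => r.2 i := (continuous_apply i).comp continuous_snd
  refine ((Complex.continuous_ofReal.comp (hχ.continuous.comp ((h1.sub continuous_const).const_smul (ℓ⁻¹ : ℝ)))).mul ?_)
  exact continuous_subtype_val.comp (Real.continuous_fourierChar.comp (h1.inner continuous_fst))

/-- **Fourier inversion against the pair wave**: for `F` continuous and integrable with integrable
transform, `∫ 𝓕F(p) conj(φ_p(x))φ_p(y) dp = χ_Λ(x)χ_Λ(y) F(y - x)`. [folklore] -/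
theorem integral_fourier_mul_conj_locWave_mul_locWave {F : Space → ℂ} (hFc : Continuous F) (hFi : Integrable F)
    (hFF : Integrable (𝓕 F)) (χ : Space → ℝ) (ℓ : ℝ) (u x y : Space) :
    ∫ p, 𝓕 F p * (conj (locWave χ ℓ u p x) * locWave χ ℓ u p y) =
      ((locFun χ ℓ u x * locFun χ ℓ u y : ℝ) : ℂ) * F (y - x) := by
  simp_rw [conj_locWave_mul_locWave]
  have h1 : ∀ p : Space, 𝓕 F p * (((locFun χ ℓ u x * locFun χ ℓ u y : ℝ) : ℂ) * (𝐞 (⟪y - x, p⟫) : ℂ)) =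
      ((locFun χ ℓ u x * locFun χ ℓ u y : ℝ) : ℂ) * ((𝐞 (⟪p, y - x⟫) : Circle) • 𝓕 F p) := fun p => by
    rw [real_inner_comm, Circle.smul_def, smul_eq_mul]; ring
  simp_rw [h1]
  rw [integral_const_mul, ← Real.fourierInv_eq, hFc.fourierInv_fourier_eq hFi hFF]

/-- **Step II of (2.29).** For a real, even, continuous, integrable potential `f` on `ℝ³` whose
Fourier transform is integrable, and `Φ ∈ L²(Λ(u)ⁿ⁺¹)`:
`∫ 𝓕f(p) ⟨b_p†Φ, b_{-p}Φ⟩ dp = ∑_{i≠j} ∫_{Λⁿ⁺¹} conj(PᵢPⱼΦ) χ_Λ(xᵢ)f(xᵢ - xⱼ)χ_Λ(xⱼ) QⱼQᵢΦ dX = ⟨Φ, A₂[f]Φ⟩`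
(Fubini in `(p, X)` — the integrand is bounded by `|𝓕f(p)|·sup χ²·|PᵢPⱼΦ||QⱼQᵢΦ|` — and Fourier
inversion `∫𝓕f(p)e^{2πi⟨xⱼ-xᵢ,p⟩}dp = f(xⱼ - xᵢ)`): the "direct calculation" behind
[Fournais2020, (2.29)] for a regular potential. [cite: Fournais2020, (2.29), (2.24)] -/
theorem integral_fourier_mul_pairing {f : Space → ℝ} (hfc : Continuous f) (hfi : Integrable f)
    (hFF : Integrable (𝓕 (fun x => (f x : ℂ)))) (hfe : ∀ x, f (-x) = f x)
    (hχ : IsLocalizationFunction χ) (hℓ : 0 < ℓ) (u : Space)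
    {Φ : Config (m + 1) → ℂ} (hΦm : Measurable Φ) (hΦ2 : MemLp Φ 2 (volume.restrict (boxConfig (m + 1) ℓ u))) :
    ∫ p, 𝓕 (fun x => (f x : ℂ)) p * ∫ X in boxConfig (m + 1) ℓ u, conj (bDagVec χ ℓ u p Φ X) * bVec χ ℓ u (-p) Φ X =
      ∑ i : Fin (m + 1), ∑ j : Fin (m + 1) with j ≠ i, ∫ X in boxConfig (m + 1) ℓ u,
        conj (nbodyP ℓ u i (nbodyP ℓ u j Φ) X) *
          ((locFun χ ℓ u (X i) * f (X i - X j) * locFun χ ℓ u (X j) : ℝ) : ℂ) * nbodyQ ℓ u j (nbodyQ ℓ u i Φ) X := by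
  obtain ⟨Cχ, hCχ⟩ := hχ.exists_bound
  set F : Space → ℂ := fun x => (f x : ℂ) with hFdef
  have hFc : Continuous F := Complex.continuous_ofReal.comp hfc
  have hFi : Integrable F := hfi.ofReal
  have hFFc : Continuous (𝓕 F) := Literature.Analysis.FluidPDE.FourierNS.continuous_fourierIntegral hFi
  -- `L²` players
  have hP : ∀ i, MemLp (nbodyP ℓ u i Φ) 2 (volume.restrict (boxConfig (m + 1) ℓ u)) := fun i => memLp_nbodyP hℓ i hΦm hΦ2
  have hPm : ∀ i, Measurable (nbodyP ℓ u i Φ) := fun i => measurable_nbodyP ℓ u i hΦm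
  have hQ : ∀ i, MemLp (nbodyQ ℓ u i Φ) 2 (volume.restrict (boxConfig (m + 1) ℓ u)) := fun i => memLp_nbodyQ hℓ i hΦm hΦ2
  have hQm : ∀ i, Measurable (nbodyQ ℓ u i Φ) := fun i => measurable_nbodyQ ℓ u i hΦm
  have hPP : ∀ i j, MemLp (nbodyP ℓ u i (nbodyP ℓ u j Φ)) 2 (volume.restrict (boxConfig (m + 1) ℓ u)) :=
    fun i j => memLp_nbodyP hℓ i (hPm j) (hP j)
  have hPPm : ∀ i j, Measurable (nbodyP ℓ u i (nbodyP ℓ u j Φ)) := fun i j => measurable_nbodyP ℓ u i (hPm j)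
  have hQQ : ∀ i j, MemLp (nbodyQ ℓ u j (nbodyQ ℓ u i Φ)) 2 (volume.restrict (boxConfig (m + 1) ℓ u)) :=
    fun i j => memLp_nbodyQ hℓ j (hQm i) (hQ i)
  have hQQm : ∀ i j, Measurable (nbodyQ ℓ u j (nbodyQ ℓ u i Φ)) := fun i j => measurable_nbodyQ ℓ u j (hQm i)
  -- the `(p, X)`-integrand of the `(i, j)` term and its integrability
  set K : Fin (m + 1) → Fin (m + 1) → Space → Config (m + 1) → ℂ := fun i j p X =>
    𝓕 F p * (conj (nbodyP ℓ u i (nbodyP ℓ u j Φ) X) * (conj (locWave χ ℓ u p (X i)) * locWave χ ℓ u p (X j)) *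
      nbodyQ ℓ u j (nbodyQ ℓ u i Φ) X) with hK
  have hKi : ∀ i j, Integrable (Function.uncurry (K i j)) (volume.prod (volume.restrict (boxConfig (m + 1) ℓ u))) := by
    intro i j
    have hmeas : AEStronglyMeasurable (Function.uncurry (K i j)) (volume.prod (volume.restrict (boxConfig (m + 1) ℓ u))) := by
      refine Continuous.aestronglyMeasurable ?_ |>.mul ?_
      · exact hFFc.comp continuous_fst
      refine ((Measurable.mul ?_ ?_).mul ?_).aestronglyMeasurable
      · exact Complex.continuous_conj.measurable.comp ((hPPm i j).comp measurable_snd)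
      · exact ((Complex.continuous_conj.comp (continuous_locWave_eval hχ ℓ u i)).mul
          (continuous_locWave_eval hχ ℓ u j)).measurable
      · exact (hQQm i j).comp measurable_snd
    have hdom : Integrable (fun r : Space × Config (m + 1) =>
        ‖𝓕 F r.1‖ * (Cχ ^ 2 * (‖nbodyP ℓ u i (nbodyP ℓ u j Φ) r.2‖ * ‖nbodyQ ℓ u j (nbodyQ ℓ u i Φ) r.2‖)))
        (volume.prod (volume.restrict (boxConfig (m + 1) ℓ u))) := by
      have hg : Integrable (fun X : Config (m + 1) =>
          Cχ ^ 2 * (‖nbodyP ℓ u i (nbodyP ℓ u j Φ) X‖ * ‖nbodyQ ℓ u j (nbodyQ ℓ u i Φ) X‖))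
          (volume.restrict (boxConfig (m + 1) ℓ u)) :=
        ((hPP i j).norm.integrable_mul (hQQ i j).norm).const_mul _
      have h := Integrable.mul_prod (f := fun p : Space => ‖𝓕 F p‖) hFF.norm hg
      exact h
    refine hdom.mono' hmeas (Filter.Eventually.of_forall fun r => ?_)
    obtain ⟨p, X⟩ := r
    rw [Function.uncurry_apply_pair]
    simp only [hK, norm_mul, Complex.norm_conj]
    have h1 : ‖locWave χ ℓ u p (X i)‖ * ‖locWave χ ℓ u p (X j)‖ ≤ Cχ ^ 2 := by
      rw [sq]
      exact mul_le_mul (norm_locWave_le hCχ ℓ u _ _) (norm_locWave_le hCχ ℓ u _ _) (norm_nonneg _)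
        ((norm_nonneg _).trans (hCχ 0))
    have h2 : 0 ≤ ‖nbodyP ℓ u i (nbodyP ℓ u j Φ) X‖ * ‖nbodyQ ℓ u j (nbodyQ ℓ u i Φ) X‖ := by positivity
    calc ‖𝓕 F p‖ * (‖nbodyP ℓ u i (nbodyP ℓ u j Φ) X‖ * (‖locWave χ ℓ u p (X i)‖ * ‖locWave χ ℓ u p (X j)‖) *
          ‖nbodyQ ℓ u j (nbodyQ ℓ u i Φ) X‖)
        = ‖𝓕 F p‖ * ((‖locWave χ ℓ u p (X i)‖ * ‖locWave χ ℓ u p (X j)‖) *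
            (‖nbodyP ℓ u i (nbodyP ℓ u j Φ) X‖ * ‖nbodyQ ℓ u j (nbodyQ ℓ u i Φ) X‖)) := by ring
      _ ≤ ‖𝓕 F p‖ * (Cχ ^ 2 * (‖nbodyP ℓ u i (nbodyP ℓ u j Φ) X‖ * ‖nbodyQ ℓ u j (nbodyQ ℓ u i Φ) X‖)) := by gcongr
  -- Step 1: expand the pairing and distribute the `p`-integral over the finite sums
  have hstep1 : ∫ p, 𝓕 F p * ∫ X in boxConfig (m + 1) ℓ u, conj (bDagVec χ ℓ u p Φ X) * bVec χ ℓ u (-p) Φ X =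
      ∑ i : Fin (m + 1), ∑ j : Fin (m + 1) with j ≠ i, ∫ p, ∫ X in boxConfig (m + 1) ℓ u, K i j p X := by
    have h1 : ∀ p, 𝓕 F p * ∫ X in boxConfig (m + 1) ℓ u, conj (bDagVec χ ℓ u p Φ X) * bVec χ ℓ u (-p) Φ X =
        ∑ i : Fin (m + 1), ∑ j : Fin (m + 1) with j ≠ i, ∫ X in boxConfig (m + 1) ℓ u, K i j p X := by
      intro p
      rw [integral_conj_bDagVec_mul_bVec hχ hℓ u p hΦm hΦ2, Finset.mul_sum]
      refine Finset.sum_congr rfl fun i _ => ?_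
      rw [Finset.mul_sum]
      refine Finset.sum_congr rfl fun j _ => ?_
      rw [← integral_const_mul]
    simp_rw [h1]
    have hint : ∀ i j, Integrable (fun p => ∫ X in boxConfig (m + 1) ℓ u, K i j p X) := fun i j => (hKi i j).integral_prod_left
    rw [integral_finsetSum _ fun i _ => integrable_finsetSum _ fun j _ => hint i j]
    exact Finset.sum_congr rfl fun i _ => integral_finsetSum _ fun j _ => hint i j
  rw [hstep1]
  refine Finset.sum_congr rfl fun i _ => Finset.sum_congr rfl fun j _ => ?_
  -- Step 2: Fubini and the Fourier inversion in `p`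
  rw [integral_integral_swap (hKi i j)]
  refine integral_congr_ae (Filter.Eventually.of_forall fun X => ?_)
  have h2 : ∀ p, K i j p X = (conj (nbodyP ℓ u i (nbodyP ℓ u j Φ) X) * nbodyQ ℓ u j (nbodyQ ℓ u i Φ) X) *
      (𝓕 F p * (conj (locWave χ ℓ u p (X i)) * locWave χ ℓ u p (X j))) := fun p => by
    simp only [hK]; ring
  simp_rw [h2]
  rw [integral_const_mul, integral_fourier_mul_conj_locWave_mul_locWave hFc hFi hFF χ ℓ u (X i) (X j), hFdef]
  simp only
  rw [← neg_sub (X i) (X j), hfe]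
  push_cast
  ring

end FourierStep

/-! ### Step III (a): the position side is `L¹`-continuous in the potential, for bounded states -/

section PositionSide

variable {m : ℕ} {χ : Space → ℝ} {ℓ : ℝ} {u : Space}

/-- `|Λ(u)ⁿ| = ℓ^{3n}`. [cite: Fournais2020, (2.6)] -/
theorem volume_boxConfig (n : ℕ) (ℓ : ℝ) (u : Space) : volume (boxConfig n ℓ u) = (ENNReal.ofReal ℓ ^ 3) ^ n := by
  rw [boxConfig_eq_pi, volume_pi_pi]
  simp only [volume_slidingBox, Finset.prod_const, Finset.card_univ, Fintype.card_fin]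

/-- `dX|_{Λⁿ}` is a finite measure. [folklore] -/
theorem isFiniteMeasure_restrict_boxConfig (n : ℕ) (ℓ : ℝ) (u : Space) :
    IsFiniteMeasure ((volume : Measure (Config n)).restrict (boxConfig n ℓ u)) := by
  refine ⟨?_⟩
  rw [Measure.restrict_apply_univ, volume_boxConfig]
  exact ENNReal.pow_lt_top (ENNReal.pow_lt_top ENNReal.ofReal_lt_top)

/-- A bounded measurable function on `Λⁿ` is in `L²(Λⁿ)`. [folklore] -/
theorem memLp_two_of_bound {n : ℕ} {Φ : Config n → ℂ} (hΦm : Measurable Φ) {M : ℝ} (hM : ∀ X, ‖Φ X‖ ≤ M) :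
    MemLp Φ 2 ((volume : Measure (Config n)).restrict (boxConfig n ℓ u)) := by
  haveI := isFiniteMeasure_restrict_boxConfig n ℓ u
  exact MemLp.of_bound hΦm.aestronglyMeasurable M (Filter.Eventually.of_forall hM)

/-- **A translation-invariant pair weight integrates to at most `ℓ^{3(n-1)}‖g‖₁` over `Λⁿ`**:
`∫_{Λⁿ⁺¹} g(xᵢ - xⱼ) dX ≤ ℓ^{3n} ∫ g` (`i ≠ j`). [folklore] -/
theorem lintegral_boxConfig_comp_sub_le (hℓ : 0 < ℓ) {i j : Fin (m + 1)} (hij : i ≠ j) {g : Space → ℝ≥0∞}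
    (hg : Measurable g) :
    ∫⁻ X in boxConfig (m + 1) ℓ u, g (X i - X j) ≤ (ENNReal.ofReal ℓ ^ 3) ^ m * ∫⁻ z, g z := by
  have hℓ3 : ENNReal.ofReal ℓ ^ 3 ≠ 0 := pow_ne_zero _ (by rwa [Ne, ENNReal.ofReal_eq_zero, not_le])
  have hℓ3' : ENNReal.ofReal ℓ ^ 3 ≠ ⊤ := ENNReal.pow_ne_top ENNReal.ofReal_ne_top
  have hw : Measurable fun p : Space × Space => g (p.1 - p.2) := hg.comp (measurable_fst.sub measurable_snd)
  have h1 := lintegral_pairWeight_mul (ℓ := ℓ) (u := u) hℓ hij (w := fun y x => g (y - x)) hw (G := fun _ => 1)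
    measurable_const (fun _ _ => rfl)
  simp only [mul_one] at h1
  rw [h1]
  calc (ENNReal.ofReal ℓ ^ 3)⁻¹ * ∫⁻ X in boxConfig (m + 1) ℓ u, ∫⁻ y in slidingBox ℓ u, g (y - X j)
      ≤ (ENNReal.ofReal ℓ ^ 3)⁻¹ * ∫⁻ X in boxConfig (m + 1) ℓ u, ∫⁻ y, g (y - X j) := by
        gcongr
        exact Measure.restrict_le_self
    _ = (ENNReal.ofReal ℓ ^ 3)⁻¹ * ((∫⁻ z, g z) * (ENNReal.ofReal ℓ ^ 3) ^ (m + 1)) := by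
        simp only [lintegral_sub_right_eq_self (μ := (volume : Measure Space)) g]
        rw [lintegral_const, Measure.restrict_apply_univ, volume_boxConfig]
    _ = (ENNReal.ofReal ℓ ^ 3) ^ m * ∫⁻ z, g z := by
        rw [pow_succ (ENNReal.ofReal ℓ ^ 3) m,
          show (∫⁻ z, g z) * ((ENNReal.ofReal ℓ ^ 3) ^ m * ENNReal.ofReal ℓ ^ 3) =
            ENNReal.ofReal ℓ ^ 3 * ((ENNReal.ofReal ℓ ^ 3) ^ m * ∫⁻ z, g z) by ring,
          ← mul_assoc, ENNReal.inv_mul_cancel hℓ3 hℓ3', one_mul]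

/-- `‖PᵢF‖_∞ ≤ ‖F‖_∞` (the box average). [cite: Fournais2020, (2.5)] -/
theorem norm_nbodyP_le_of_bound {n : ℕ} (hℓ : 0 < ℓ) (i : Fin n) {F : Config n → ℂ} {M : ℝ} (hM : ∀ Y, ‖F Y‖ ≤ M)
    (X : Config n) : ‖nbodyP ℓ u i F X‖ ≤ M := by
  rw [nbodyP, norm_smul, Real.norm_eq_abs, abs_of_pos (by positivity)]
  have h1 : ‖∫ y in slidingBox ℓ u, F (Function.update X i y)‖ ≤ M * ℓ ^ 3 := by
    refine (norm_setIntegral_le_of_norm_le_const (by rw [volume_slidingBox]; exact ENNReal.pow_lt_top ENNReal.ofReal_lt_top)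
      fun y _ => hM _).trans_eq ?_
    rw [measureReal_def, volume_slidingBox, ← ENNReal.ofReal_pow hℓ.le, ENNReal.toReal_ofReal (by positivity)]
  calc (ℓ ^ 3)⁻¹ * ‖∫ y in slidingBox ℓ u, F (Function.update X i y)‖ ≤ (ℓ ^ 3)⁻¹ * (M * ℓ ^ 3) := by gcongr
    _ = M := by field_simp

/-- `‖QᵢF‖_∞ ≤ 2‖F‖_∞`. [cite: Fournais2020, (2.5)] -/
theorem norm_nbodyQ_le_of_bound {n : ℕ} (hℓ : 0 < ℓ) (i : Fin n) {F : Config n → ℂ} {M : ℝ} (hM : ∀ Y, ‖F Y‖ ≤ M)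
    (X : Config n) : ‖nbodyQ ℓ u i F X‖ ≤ 2 * M := by
  rw [nbodyQ, two_mul]
  exact (norm_sub_le _ _).trans (add_le_add (hM X) (norm_nbodyP_le_of_bound hℓ i hM X))

/-- The `X`-integrand of the `(i, j)` pair term against a potential `f ∈ L¹(ℝ³)`,
`conj(PᵢPⱼΦ) χ_Λ(xᵢ)f(xᵢ-xⱼ)χ_Λ(xⱼ) QⱼQᵢΦ`, is integrable on `Λⁿ⁺¹` for bounded measurable `Φ`, with
`∫|·| ≤ 4M² sup χ² ℓ^{3n} ‖f‖₁`. [cite: Fournais2020, (2.24)] -/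
theorem integrable_pairTerm_of_bound (hχ : IsLocalizationFunction χ) {Cχ : ℝ} (hCχ : ∀ x, ‖χ x‖ ≤ Cχ) (hℓ : 0 < ℓ)
    {i j : Fin (m + 1)} (hij : i ≠ j) {f : Space → ℝ} (hfm : Measurable f) (hf : Integrable f)
    {Φ : Config (m + 1) → ℂ} (hΦm : Measurable Φ) {M : ℝ} (hM : ∀ X, ‖Φ X‖ ≤ M) :
    Integrable (fun X => conj (nbodyP ℓ u i (nbodyP ℓ u j Φ) X) *
        ((locFun χ ℓ u (X i) * f (X i - X j) * locFun χ ℓ u (X j) : ℝ) : ℂ) * nbodyQ ℓ u j (nbodyQ ℓ u i Φ) X)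
      (volume.restrict (boxConfig (m + 1) ℓ u)) ∧
    ∫⁻ X in boxConfig (m + 1) ℓ u, ‖conj (nbodyP ℓ u i (nbodyP ℓ u j Φ) X) *
        ((locFun χ ℓ u (X i) * f (X i - X j) * locFun χ ℓ u (X j) : ℝ) : ℂ) * nbodyQ ℓ u j (nbodyQ ℓ u i Φ) X‖ₑ ≤
      ENNReal.ofReal (M * Cχ ^ 2 * (4 * M)) * (ENNReal.ofReal ℓ ^ 3) ^ m * ∫⁻ z, ‖f z‖ₑ := by
  have hC0 : 0 ≤ Cχ := (norm_nonneg _).trans (hCχ 0)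
  have hM0 : 0 ≤ M := (norm_nonneg _).trans (hM 0)
  have hPm : Measurable (nbodyP ℓ u i (nbodyP ℓ u j Φ)) := measurable_nbodyP ℓ u i (measurable_nbodyP ℓ u j hΦm)
  have hQm : Measurable (nbodyQ ℓ u j (nbodyQ ℓ u i Φ)) := measurable_nbodyQ ℓ u j (measurable_nbodyQ ℓ u i hΦm)
  have hPb : ∀ X, ‖nbodyP ℓ u i (nbodyP ℓ u j Φ) X‖ ≤ M := fun X =>
    norm_nbodyP_le_of_bound (u := u) hℓ i (norm_nbodyP_le_of_bound (u := u) hℓ j hM) X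
  have hQb : ∀ X, ‖nbodyQ ℓ u j (nbodyQ ℓ u i Φ) X‖ ≤ 4 * M := fun X => by
    have h := norm_nbodyQ_le_of_bound (u := u) hℓ j (norm_nbodyQ_le_of_bound (u := u) hℓ i hM) X
    linarith
  have hχb : ∀ y, ‖locFun χ ℓ u y‖ ≤ Cχ := fun y => hCχ _
  have hwm : Measurable fun X : Config (m + 1) => ((locFun χ ℓ u (X i) * f (X i - X j) * locFun χ ℓ u (X j) : ℝ) : ℂ) := by
    refine Complex.measurable_ofReal.comp ((Measurable.mul ?_ ?_).mul ?_)
    · exact (measurable_locFun_right hχ ℓ u).comp (measurable_pi_apply i)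
    · exact hfm.comp ((measurable_pi_apply i).sub (measurable_pi_apply j))
    · exact (measurable_locFun_right hχ ℓ u).comp (measurable_pi_apply j)
  have hIm : Measurable fun X => conj (nbodyP ℓ u i (nbodyP ℓ u j Φ) X) *
      ((locFun χ ℓ u (X i) * f (X i - X j) * locFun χ ℓ u (X j) : ℝ) : ℂ) * nbodyQ ℓ u j (nbodyQ ℓ u i Φ) X :=
    ((Complex.continuous_conj.measurable.comp hPm).mul hwm).mul hQm
  -- pointwise bound
  have hpt : ∀ X, ‖conj (nbodyP ℓ u i (nbodyP ℓ u j Φ) X) *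
      ((locFun χ ℓ u (X i) * f (X i - X j) * locFun χ ℓ u (X j) : ℝ) : ℂ) * nbodyQ ℓ u j (nbodyQ ℓ u i Φ) X‖ₑ ≤
      ENNReal.ofReal (M * Cχ ^ 2 * (4 * M)) * ‖f (X i - X j)‖ₑ := by
    intro X
    rw [← ofReal_norm, Real.enorm_eq_ofReal_abs, ← ENNReal.ofReal_mul (by positivity)]
    refine ENNReal.ofReal_le_ofReal ?_
    rw [norm_mul, norm_mul, Complex.norm_conj, Complex.norm_real, Real.norm_eq_abs, abs_mul, abs_mul]
    have h1 : |locFun χ ℓ u (X i)| ≤ Cχ := Real.norm_eq_abs _ ▸ hχb _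
    have h2 : |locFun χ ℓ u (X j)| ≤ Cχ := Real.norm_eq_abs _ ▸ hχb _
    calc ‖nbodyP ℓ u i (nbodyP ℓ u j Φ) X‖ * (|locFun χ ℓ u (X i)| * |f (X i - X j)| * |locFun χ ℓ u (X j)|) *
          ‖nbodyQ ℓ u j (nbodyQ ℓ u i Φ) X‖
        = ‖nbodyP ℓ u i (nbodyP ℓ u j Φ) X‖ * (|locFun χ ℓ u (X i)| * |locFun χ ℓ u (X j)|) *
            ‖nbodyQ ℓ u j (nbodyQ ℓ u i Φ) X‖ * |f (X i - X j)| := by ring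
      _ ≤ M * (Cχ * Cχ) * (4 * M) * |f (X i - X j)| := by
          refine mul_le_mul_of_nonneg_right ?_ (abs_nonneg _)
          exact mul_le_mul (mul_le_mul (hPb X) (mul_le_mul h1 h2 (abs_nonneg _) hC0) (by positivity) hM0) (hQb X)
            (norm_nonneg _) (by positivity)
      _ = M * Cχ ^ 2 * (4 * M) * |f (X i - X j)| := by ring
  have hlin : ∫⁻ X in boxConfig (m + 1) ℓ u, ‖conj (nbodyP ℓ u i (nbodyP ℓ u j Φ) X) *
      ((locFun χ ℓ u (X i) * f (X i - X j) * locFun χ ℓ u (X j) : ℝ) : ℂ) * nbodyQ ℓ u j (nbodyQ ℓ u i Φ) X‖ₑ ≤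
      ENNReal.ofReal (M * Cχ ^ 2 * (4 * M)) * (ENNReal.ofReal ℓ ^ 3) ^ m * ∫⁻ z, ‖f z‖ₑ := by
    calc _ ≤ ∫⁻ X in boxConfig (m + 1) ℓ u, ENNReal.ofReal (M * Cχ ^ 2 * (4 * M)) * ‖f (X i - X j)‖ₑ := lintegral_mono hpt
      _ = ENNReal.ofReal (M * Cχ ^ 2 * (4 * M)) * ∫⁻ X in boxConfig (m + 1) ℓ u, ‖f (X i - X j)‖ₑ :=
          lintegral_const_mul _ (hfm.enorm.comp ((measurable_pi_apply i).sub (measurable_pi_apply j)))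
      _ ≤ ENNReal.ofReal (M * Cχ ^ 2 * (4 * M)) * ((ENNReal.ofReal ℓ ^ 3) ^ m * ∫⁻ z, ‖f z‖ₑ) :=
          mul_le_mul_right (lintegral_boxConfig_comp_sub_le hℓ hij hfm.enorm) _
      _ = _ := (mul_assoc _ _ _).symm
  refine ⟨⟨hIm.aestronglyMeasurable, ?_⟩, hlin⟩
  rw [hasFiniteIntegral_iff_enorm]
  refine lt_of_le_of_lt hlin ?_
  have hf1 : ∫⁻ z, ‖f z‖ₑ < ⊤ := hf.2
  exact ENNReal.mul_lt_top (ENNReal.mul_lt_top ENNReal.ofReal_lt_top (ENNReal.pow_lt_top (ENNReal.pow_lt_top ENNReal.ofReal_lt_top))) hf1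

/-- **The position side is Lipschitz in `L¹`.** For bounded measurable `Φ` on `Λⁿ⁺¹` the pair term
`f ↦ ∫conj(PᵢPⱼΦ)χ_Λ(xᵢ)f(xᵢ-xⱼ)χ_Λ(xⱼ)QⱼQᵢΦ` is linear with `|T(f) - T(g)| ≤ 4M² sup χ² ℓ^{3n} ‖f - g‖₁`.
[cite: Fournais2020, (2.24), (2.29)] -/
theorem norm_pairTerm_sub_le (hχ : IsLocalizationFunction χ) {Cχ : ℝ} (hCχ : ∀ x, ‖χ x‖ ≤ Cχ) (hℓ : 0 < ℓ)
    {i j : Fin (m + 1)} (hij : i ≠ j) {f g : Space → ℝ} (hfm : Measurable f) (hf : Integrable f)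
    (hgm : Measurable g) (hg : Integrable g)
    {Φ : Config (m + 1) → ℂ} (hΦm : Measurable Φ) {M : ℝ} (hM : ∀ X, ‖Φ X‖ ≤ M) :
    ‖(∫ X in boxConfig (m + 1) ℓ u, conj (nbodyP ℓ u i (nbodyP ℓ u j Φ) X) *
        ((locFun χ ℓ u (X i) * f (X i - X j) * locFun χ ℓ u (X j) : ℝ) : ℂ) * nbodyQ ℓ u j (nbodyQ ℓ u i Φ) X) -
      ∫ X in boxConfig (m + 1) ℓ u, conj (nbodyP ℓ u i (nbodyP ℓ u j Φ) X) *
        ((locFun χ ℓ u (X i) * g (X i - X j) * locFun χ ℓ u (X j) : ℝ) : ℂ) * nbodyQ ℓ u j (nbodyQ ℓ u i Φ) X‖ ≤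
      M * Cχ ^ 2 * (4 * M) * (ℓ ^ 3) ^ m * ∫ z, ‖f z - g z‖ := by
  have hM0 : 0 ≤ M := (norm_nonneg _).trans (hM 0)
  obtain ⟨hIf, -⟩ := integrable_pairTerm_of_bound (u := u) hχ hCχ hℓ hij hfm hf hΦm hM
  obtain ⟨hIg, -⟩ := integrable_pairTerm_of_bound (u := u) hχ hCχ hℓ hij hgm hg hΦm hM
  obtain ⟨hIfg, hle⟩ := integrable_pairTerm_of_bound (u := u) hχ hCχ hℓ hij (hfm.sub hgm) (hf.sub hg) hΦm hM
  rw [← integral_sub hIf hIg]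
  have h1 : ∀ X, conj (nbodyP ℓ u i (nbodyP ℓ u j Φ) X) *
        ((locFun χ ℓ u (X i) * f (X i - X j) * locFun χ ℓ u (X j) : ℝ) : ℂ) * nbodyQ ℓ u j (nbodyQ ℓ u i Φ) X -
      conj (nbodyP ℓ u i (nbodyP ℓ u j Φ) X) *
        ((locFun χ ℓ u (X i) * g (X i - X j) * locFun χ ℓ u (X j) : ℝ) : ℂ) * nbodyQ ℓ u j (nbodyQ ℓ u i Φ) X =
      conj (nbodyP ℓ u i (nbodyP ℓ u j Φ) X) *
        ((locFun χ ℓ u (X i) * (f - g) (X i - X j) * locFun χ ℓ u (X j) : ℝ) : ℂ) * nbodyQ ℓ u j (nbodyQ ℓ u i Φ) X := by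
    intro X; simp only [Pi.sub_apply]; push_cast; ring
  simp_rw [h1]
  refine (norm_integral_le_lintegral_norm _).trans ?_
  have h2 : (∫⁻ X in boxConfig (m + 1) ℓ u, ENNReal.ofReal ‖conj (nbodyP ℓ u i (nbodyP ℓ u j Φ) X) *
      ((locFun χ ℓ u (X i) * (f - g) (X i - X j) * locFun χ ℓ u (X j) : ℝ) : ℂ) * nbodyQ ℓ u j (nbodyQ ℓ u i Φ) X‖) ≤
      ENNReal.ofReal (M * Cχ ^ 2 * (4 * M)) * (ENNReal.ofReal ℓ ^ 3) ^ m * ∫⁻ z, ‖(f - g) z‖ₑ := by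
    simpa only [ofReal_norm] using hle
  have h3 : ∫⁻ z, ‖(f - g) z‖ₑ = ENNReal.ofReal (∫ z, ‖f z - g z‖) := by
    rw [← ofReal_integral_norm_eq_lintegral_enorm (hf.sub hg)]
    rfl
  rw [h3, ← ENNReal.ofReal_pow hℓ.le, ← ENNReal.ofReal_pow (by positivity), ← ENNReal.ofReal_mul (by positivity),
    ← ENNReal.ofReal_mul (by positivity)] at h2
  refine (ENNReal.toReal_mono ENNReal.ofReal_ne_top h2).trans_eq ?_
  rw [ENNReal.toReal_ofReal (by positivity), ← pow_mul]

/-- **`⟨Φ, A₂Φ⟩` is the real part of the pair sum against `W₁`**: `a2Form` written with the real kernel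
`χ_Λ(xᵢ) W₁(xᵢ - xⱼ) χ_Λ(xⱼ)` (`w₁ = χ_ΛW₁χ_Λ` (2.8); `toReal` of the `ℝ≥0∞` product). [cite: Fournais2020, (2.24), (2.8)] -/
theorem a2Form_eq_re_sum {n : ℕ} (v : ℝ → ℝ≥0∞) (ω : Space → ℝ) (hχ : IsLocalizationFunction χ) (ℓ : ℝ) (u : Space)
    (Φ : Config n → ℂ) :
    a2Form v ω χ ℓ u Φ = (∑ i : Fin n, ∑ j : Fin n with j ≠ i, ∫ X in boxConfig n ℓ u,
      conj (nbodyP ℓ u i (nbodyP ℓ u j Φ) X) *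
        ((locFun χ ℓ u (X i) * (bigW₁ v ω χ ℓ (X i - X j)).toReal * locFun χ ℓ u (X j) : ℝ) : ℂ) *
          nbodyQ ℓ u j (nbodyQ ℓ u i Φ) X).re := by
  unfold a2Form
  rw [Complex.re_sum]
  refine Finset.sum_congr rfl fun i _ => ?_
  rw [Complex.re_sum]
  refine Finset.sum_congr rfl fun j _ => ?_
  congr 1
  refine integral_congr_ae (Filter.Eventually.of_forall fun X => ?_)
  simp only [pairLoc₁, ENNReal.toReal_mul, ENNReal.toReal_ofReal (locFun_nonneg hχ ℓ u _)]

end PositionSide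

/-! ### Step III (b): mollification of the potential and its Fourier side -/

section Mollify

open Filter Topology ContinuousLinearMap
open scoped Convolution SchwartzMap

/-- **A real even integrable function has a real Fourier transform**: `conj 𝓕f(p) = 𝓕f(-p) = 𝓕f(p)`. [folklore] -/
theorem im_fourier_ofReal_eq_zero {f : Space → ℝ} (hfe : ∀ x, f (-x) = f x) (p : Space) :
    (𝓕 (fun x => (f x : ℂ)) p).im = 0 := by
  have hconj : conj (𝓕 (fun x => (f x : ℂ)) p) = 𝓕 (fun x => (f x : ℂ)) p := by
    have h1 : conj (𝓕 (fun x => (f x : ℂ)) p) = 𝓕 (fun x => (f x : ℂ)) (-p) := by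
      rw [Real.fourier_eq, Real.fourier_eq, ← integral_conj]
      refine integral_congr_ae (Eventually.of_forall fun x => ?_)
      simp only [Circle.smul_def, smul_eq_mul, map_mul, Complex.conj_ofReal, inner_neg_right, neg_neg,
        ← Circle.coe_inv_eq_conj, ← AddChar.map_neg_eq_inv]
    rw [h1, ← Real.fourierInv_eq_fourier_neg, Real.fourierInv_eq_fourier_comp_neg]
    simp_rw [hfe]
  exact Complex.conj_eq_iff_im.1 hconj

variable {f : Space → ℝ}

/-- The complexified normalised bump is a Schwartz function; its Fourier transform is integrable and
bounded by `1`. [folklore] -/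
theorem fourier_normed_props (φ : ContDiffBump (0 : Space)) :
    Integrable (𝓕 (fun x => ((φ.normed volume x : ℝ) : ℂ))) ∧
      ∀ p, ‖𝓕 (fun x => ((φ.normed volume x : ℝ) : ℂ)) p‖ ≤ 1 := by
  set ψ : Space → ℂ := fun x => ((φ.normed volume x : ℝ) : ℂ) with hψ
  have hψs : HasCompactSupport ψ := φ.hasCompactSupport_normed.comp_left Complex.ofReal_zero
  have hψd : ContDiff ℝ (⊤ : ℕ∞) ψ := (Complex.ofRealCLM.contDiff.of_le le_top).comp φ.contDiff_normed
  refine ⟨?_, fun p => ?_⟩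
  · have h : 𝓕 ψ = ((𝓕 (hψs.toSchwartzMap hψd) : 𝓢(Space, ℂ)) : Space → ℂ) := by
      rw [SchwartzMap.fourier_coe]; rfl
    rw [h]
    exact (𝓕 (hψs.toSchwartzMap hψd)).integrable
  · rw [Real.fourier_eq]
    refine (norm_integral_le_integral_norm _).trans ?_
    have h1 : ∀ v : Space, ‖(𝐞 (-⟪v, p⟫) : Circle) • ψ v‖ = φ.normed volume v := fun v => by
      rw [Circle.norm_smul, hψ, Complex.norm_real, Real.norm_of_nonneg (φ.nonneg_normed v)]
    simp_rw [h1]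
    rw [φ.integral_normed]

/-- **The bump transforms tend to `1` pointwise** as the radii shrink (`𝓕ψ_k(p) = (ψ_k ⋆ e_p)(0) → e_p(0) = 1`).
[folklore] -/
theorem tendsto_fourier_normed {φ : ℕ → ContDiffBump (0 : Space)} (hφ : Tendsto (fun k => (φ k).rOut) atTop (𝓝 0))
    (p : Space) : Tendsto (fun k => 𝓕 (fun x => (((φ k).normed volume x : ℝ) : ℂ)) p) atTop (𝓝 1) := by
  set g : Space → ℂ := fun y => ((𝐞 (⟪y, p⟫) : Circle) : ℂ) with hg
  have hgc : Continuous g := continuous_subtype_val.comp (Real.continuous_fourierChar.comp (continuous_id.inner continuous_const))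
  have hconv : ∀ k, 𝓕 (fun x => (((φ k).normed volume x : ℝ) : ℂ)) p = ((φ k).normed volume ⋆[lsmul ℝ ℝ, volume] g) 0 := by
    intro k
    rw [Real.fourier_eq, convolution_lsmul]
    refine integral_congr_ae (Eventually.of_forall fun t => ?_)
    simp only [hg, zero_sub, inner_neg_left, Circle.smul_def, smul_eq_mul, Complex.real_smul, mul_comm]
  simp_rw [hconv]
  have hg0 : g 0 = 1 := by simp [hg]
  rw [← hg0]
  refine ContDiffBump.convolution_tendsto_right (g := fun _ => g) (k := fun _ => 0) hφ
    (Eventually.of_forall fun _ => hgc.aestronglyMeasurable) ?_ tendsto_const_nhds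
  exact (hgc.tendsto 0).comp tendsto_snd

/-- **The mollified potential.** For `f ∈ L¹(ℝ³)` real, even and measurable, and a normalised bump `ψ`,
`ψ ⋆ f` is continuous, integrable and even, and its (complexified) Fourier transform is `𝓕ψ · 𝓕f`,
an integrable function. [folklore] -/
theorem normed_convolution_props (φ : ContDiffBump (0 : Space)) (hfi : Integrable f) (hfe : ∀ x, f (-x) = f x) :
    Continuous (φ.normed volume ⋆[lsmul ℝ ℝ, volume] f) ∧ Integrable (φ.normed volume ⋆[lsmul ℝ ℝ, volume] f) ∧
      (∀ x, (φ.normed volume ⋆[lsmul ℝ ℝ, volume] f) (-x) = (φ.normed volume ⋆[lsmul ℝ ℝ, volume] f) x) ∧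
      (∀ p, 𝓕 (fun x => (((φ.normed volume ⋆[lsmul ℝ ℝ, volume] f) x : ℝ) : ℂ)) p =
        𝓕 (fun x => ((φ.normed volume x : ℝ) : ℂ)) p * 𝓕 (fun x => (f x : ℂ)) p) ∧
      Integrable (𝓕 (fun x => (((φ.normed volume ⋆[lsmul ℝ ℝ, volume] f) x : ℝ) : ℂ))) := by
  set ψ : Space → ℂ := fun x => ((φ.normed volume x : ℝ) : ℂ) with hψ
  set F : Space → ℂ := fun x => (f x : ℂ) with hF
  have hcont : Continuous (φ.normed volume ⋆[lsmul ℝ ℝ, volume] f) :=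
    φ.hasCompactSupport_normed.continuous_convolution_left _ φ.continuous_normed hfi.locallyIntegrable
  have hint : Integrable (φ.normed volume ⋆[lsmul ℝ ℝ, volume] f) := φ.integrable_normed.integrable_convolution _ hfi
  have heven : ∀ x, (φ.normed volume ⋆[lsmul ℝ ℝ, volume] f) (-x) = (φ.normed volume ⋆[lsmul ℝ ℝ, volume] f) x :=
    fun x => convolution_neg_of_neg_eq (lsmul ℝ ℝ) (Eventually.of_forall fun y => φ.normed_neg y) (Eventually.of_forall hfe)
  -- the complexification is the complex convolution
  have hcx : (fun x => (((φ.normed volume ⋆[lsmul ℝ ℝ, volume] f) x : ℝ) : ℂ)) = ψ ⋆[mul ℂ ℂ, volume] F := by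
    funext x
    rw [convolution_lsmul, convolution_mul, ← integral_complex_ofReal]
    refine integral_congr_ae (Eventually.of_forall fun t => ?_)
    simp only [hψ, hF, smul_eq_mul, Complex.ofReal_mul]
  have hfour : ∀ p, 𝓕 (fun x => (((φ.normed volume ⋆[lsmul ℝ ℝ, volume] f) x : ℝ) : ℂ)) p = 𝓕 ψ p * 𝓕 F p := by
    intro p
    rw [hcx]
    exact Real.fourier_mul_convolution_eq φ.integrable_normed.ofReal hfi.ofReal p
  obtain ⟨hψF, hψ1⟩ := fourier_normed_props φ
  refine ⟨hcont, hint, heven, hfour, ?_⟩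
  have heq : 𝓕 (fun x => (((φ.normed volume ⋆[lsmul ℝ ℝ, volume] f) x : ℝ) : ℂ)) = fun p => 𝓕 ψ p * 𝓕 F p := funext hfour
  rw [heq]
  have hFc : Continuous (𝓕 F) := Literature.Analysis.FluidPDE.FourierNS.continuous_fourierIntegral hfi.ofReal
  refine hψF.mul_bdd (c := ∫ x, ‖F x‖) hFc.aestronglyMeasurable (Eventually.of_forall fun p => ?_)
  rw [Real.fourier_eq]
  refine (norm_integral_le_integral_norm _).trans (le_of_eq ?_)
  refine integral_congr_ae (Eventually.of_forall fun v => ?_)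
  simp only [Circle.norm_smul]

end Mollify

/-! ### Step III (c): the dominating function on the momentum side -/

section Domination

open Filter

variable {m : ℕ} {χ : Space → ℝ} {ℓ : ℝ} {u : Space}

/-- AM–GM with a weight: `ab ≤ ½(a²/t + tb²)` for `t > 0`. [folklore] -/
theorem mul_le_half_weighted {a b t : ℝ} (ht : 0 < t) : a * b ≤ 1 / 2 * (a ^ 2 / t + t * b ^ 2) := by
  have key : 1 / 2 * (a ^ 2 / t + t * b ^ 2) - a * b = (a - t * b) ^ 2 / (2 * t) := by
    field_simp
    ring
  have h0 : 0 ≤ (a - t * b) ^ 2 / (2 * t) := by positivity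
  linarith

/-- `2 · ofReal x = ofReal (2x)`. [folklore] -/
theorem two_mul_ofReal (x : ℝ) : 2 * ENNReal.ofReal x = ENNReal.ofReal (2 * x) := by
  rw [ENNReal.ofReal_mul (by norm_num : (0 : ℝ) ≤ 2), ENNReal.ofReal_ofNat]

/-- `8π²|p|² ≤ 2(4π²|p|² - σ²)₊ + 2σ²` in `ℝ≥0∞`. [cite: Fournais2020, (2.30), (2.37)] -/
theorem ofReal_weight_le (σ : ℝ) (p : Space) :
    ENNReal.ofReal (8 * Real.pi ^ 2 * ‖p‖ ^ 2) ≤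
      2 * ENNReal.ofReal (4 * Real.pi ^ 2 * ‖p‖ ^ 2 - σ ^ 2) + 2 * ENNReal.ofReal (σ ^ 2) := by
  rw [two_mul_ofReal, two_mul_ofReal]
  rcases le_or_gt 0 (4 * Real.pi ^ 2 * ‖p‖ ^ 2 - σ ^ 2) with h | h
  · rw [← ENNReal.ofReal_add (by positivity) (by positivity)]
    exact ENNReal.ofReal_le_ofReal (by nlinarith)
  · calc ENNReal.ofReal (8 * Real.pi ^ 2 * ‖p‖ ^ 2) ≤ ENNReal.ofReal (2 * σ ^ 2) := ENNReal.ofReal_le_ofReal (by nlinarith)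
      _ ≤ _ := le_add_self

/-- Lebesgue measure on `ℝ³` does not see the origin. [folklore] -/
theorem ae_ne_zero_space : ∀ᵐ p ∂(volume : Measure Space), p ≠ 0 := by
  have h : (volume : Measure Space) {0} = 0 := measure_singleton 0
  rw [ae_iff]
  simpa only [ne_eq, not_not, Set.setOf_eq_eq_singleton] using h

/-- **The dominating function for (2.29).** Let `Φ ∈ L²(Λⁿ⁺¹)` be measurable with finite `⟨n₊⟩`,
`∫(4π²p² - σ²)₊‖b_pΦ‖²dp < ∞` and `∫‖b_pΦ‖²dp < ∞` ((2.30), (2.32)), and let `G` be continuous with finite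
Coulomb energy `∫|G|²/(8π²p²) < ∞` ((2.42)). Then `p ↦ |G(p)|·|⟨b_p†Φ, b_{-p}Φ⟩|` is dominated by an
integrable function (Cauchy–Schwarz `|⟨b†Φ,bΦ⟩| ≤ ‖b_p†Φ‖‖b_{-p}Φ‖`, `sup_p‖b_p†Φ‖ < ∞`, and
`|G|‖b_{-p}Φ‖ ≤ ½(|G|²/(8π²p²) + 8π²p²‖b_{-p}Φ‖²)`): the absolute convergence of the momentum
integral in [Fournais2020, (2.29)]. [cite: Fournais2020, (2.29)–(2.32), (2.42)] -/
theorem exists_integrable_bound_pairing (hχ : IsLocalizationFunction χ) {Cχ : ℝ} (hCχ : ∀ x, ‖χ x‖ ≤ Cχ) (hℓ : 0 < ℓ)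
    (u : Space) {Φ : Config (m + 1) → ℂ} (hΦm : Measurable Φ)
    (hN2 : (∫⁻ X in boxConfig (m + 1) ℓ u, ((‖Φ X‖₊ : ℝ≥0∞)) ^ 2) ≠ ⊤) (hNP : nPlusBoxN ℓ u Φ ≠ ⊤) {σ : ℝ}
    (hτ : (∫⁻ p : Space, ENNReal.ofReal (4 * Real.pi ^ 2 * ‖p‖ ^ 2 - σ ^ 2) *
      ∫⁻ X in boxConfig (m + 1) ℓ u, ((‖bVec χ ℓ u p Φ X‖₊ : ℝ≥0∞)) ^ 2) ≠ ⊤)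
    (hN0 : (∫⁻ p : Space, ∫⁻ X in boxConfig (m + 1) ℓ u, ((‖bVec χ ℓ u p Φ X‖₊ : ℝ≥0∞)) ^ 2) ≠ ⊤)
    {G : Space → ℂ} (hGc : Continuous G)
    (hGcoul : (∫⁻ p : Space, ENNReal.ofReal (‖G p‖ ^ 2 / (8 * Real.pi ^ 2 * ‖p‖ ^ 2))) ≠ ⊤) :
    ∃ bound : Space → ℝ, Integrable bound ∧
      ∀ p, ‖G p‖ * ‖∫ X in boxConfig (m + 1) ℓ u, conj (bDagVec χ ℓ u p Φ X) * bVec χ ℓ u (-p) Φ X‖ ≤ bound p := by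
  have hχc := hχ.continuous
  -- the functions `p ↦ ‖b_pΦ‖²`, `‖b_p†Φ‖²` and their finiteness
  set Nb : Space → ℝ≥0∞ := fun p => ∫⁻ X in boxConfig (m + 1) ℓ u, ((‖bVec χ ℓ u p Φ X‖₊ : ℝ≥0∞)) ^ 2 with hNb
  have hNbm : Measurable Nb := measurable_lintegral_normSq_bVec hχc ℓ u hΦm
  have hNbm' : Measurable fun p => Nb (-p) := hNbm.comp measurable_neg
  have hNbfin : ∀ p, Nb p ≠ ⊤ := fun p =>
    ne_top_of_le_ne_top (ENNReal.mul_ne_top ENNReal.ofReal_ne_top hNP) (lintegral_normSq_bVec_le_nPlus hχ hCχ hℓ u p hΦm)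
  set Dd : ℝ≥0∞ := ENNReal.ofReal (((m + 1 : ℕ) : ℝ) * (2 * Cχ) ^ 2) * (m + 1 : ℕ) *
    ∫⁻ X in boxConfig (m + 1) ℓ u, ((‖Φ X‖₊ : ℝ≥0∞)) ^ 2 with hDd
  have hDdt : Dd ≠ ⊤ := ENNReal.mul_ne_top (ENNReal.mul_ne_top ENNReal.ofReal_ne_top (ENNReal.natCast_ne_top _)) hN2
  have hD : ∀ p, ∫⁻ X in boxConfig (m + 1) ℓ u, ((‖bDagVec χ ℓ u p Φ X‖₊ : ℝ≥0∞)) ^ 2 ≤ Dd := fun p =>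
    lintegral_normSq_bDagVec_le hCχ hℓ u p hΦm
  -- the real constants and functions
  set cd : ℝ := (Dd ^ (1 / 2 : ℝ)).toReal with hcd
  set nb : Space → ℝ := fun p => ((Nb (-p)) ^ (1 / 2 : ℝ)).toReal with hnb
  have hcd0 : 0 ≤ cd := ENNReal.toReal_nonneg
  have hnb0 : ∀ p, 0 ≤ nb p := fun p => ENNReal.toReal_nonneg
  have hnbm : Measurable nb := (hNbm'.pow_const _).ennreal_toReal
  have hnb2 : ∀ p, nb p ^ 2 = (Nb (-p)).toReal := fun p => by
    rw [hnb, ← ENNReal.toReal_pow, ← ENNReal.rpow_two, ← ENNReal.rpow_mul]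
    norm_num
  -- Cauchy–Schwarz: `‖Z p‖ ≤ cd · nb p`
  have hCS : ∀ p, ‖∫ X in boxConfig (m + 1) ℓ u, conj (bDagVec χ ℓ u p Φ X) * bVec χ ℓ u (-p) Φ X‖ ≤ cd * nb p := by
    intro p
    have hF : AEMeasurable (bDagVec χ ℓ u p Φ) (volume.restrict (boxConfig (m + 1) ℓ u)) :=
      (measurable_bDagVec hχc ℓ u p hΦm).aemeasurable
    have hG' := (measurable_bVec hχc ℓ u hΦm).comp (measurable_prodMk_right (y := -p))
    have hGm : AEMeasurable (bVec χ ℓ u (-p) Φ) (volume.restrict (boxConfig (m + 1) ℓ u)) := hG'.aemeasurable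
    have h1 := enorm_integral_conj_mul_le (volume.restrict (boxConfig (m + 1) ℓ u)) hF hGm
    have h2 : ‖∫ X in boxConfig (m + 1) ℓ u, conj (bDagVec χ ℓ u p Φ X) * bVec χ ℓ u (-p) Φ X‖ₑ ≤
        Dd ^ (1 / 2 : ℝ) * (Nb (-p)) ^ (1 / 2 : ℝ) :=
      h1.trans (mul_le_mul_left (ENNReal.rpow_le_rpow (hD p) (by norm_num)) _)
    have hfin : Dd ^ (1 / 2 : ℝ) * (Nb (-p)) ^ (1 / 2 : ℝ) ≠ ⊤ :=
      ENNReal.mul_ne_top (ENNReal.rpow_ne_top_of_nonneg (by norm_num) hDdt)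
        (ENNReal.rpow_ne_top_of_nonneg (by norm_num) (hNbfin _))
    have h3 := ENNReal.toReal_mono hfin h2
    rwa [← ofReal_norm, ENNReal.toReal_ofReal (norm_nonneg _), ENNReal.toReal_mul] at h3
  -- the bound
  refine ⟨fun p => ‖G p‖ * (cd * nb p), ?_, fun p => mul_le_mul_of_nonneg_left (hCS p) (norm_nonneg _)⟩
  have hbm : AEStronglyMeasurable (fun p => ‖G p‖ * (cd * nb p)) volume :=
    (hGc.norm.measurable.mul (measurable_const.mul hnbm)).aestronglyMeasurable
  have hb0 : ∀ p, 0 ≤ ‖G p‖ * (cd * nb p) := fun p => by positivity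
  refine ⟨hbm, ?_⟩
  rw [hasFiniteIntegral_iff_enorm]
  -- pointwise AM–GM for `p ≠ 0`
  have hpt : ∀ p : Space, p ≠ 0 → ‖‖G p‖ * (cd * nb p)‖ₑ ≤
      ENNReal.ofReal (cd / 2) * (ENNReal.ofReal (‖G p‖ ^ 2 / (8 * Real.pi ^ 2 * ‖p‖ ^ 2)) +
        ENNReal.ofReal (8 * Real.pi ^ 2 * ‖p‖ ^ 2) * Nb (-p)) := by
    intro p hp
    have ht : 0 < 8 * Real.pi ^ 2 * ‖p‖ ^ 2 := by
      have := norm_pos_iff.2 hp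
      positivity
    have h1 := mul_le_half_weighted (a := ‖G p‖) (b := nb p) ht
    rw [hnb2 p] at h1
    rw [Real.enorm_eq_ofReal (hb0 p), ← ENNReal.ofReal_toReal (hNbfin (-p)), ← ENNReal.ofReal_mul (by positivity),
      ← ENNReal.ofReal_add (by positivity) (by positivity), ← ENNReal.ofReal_mul (by positivity)]
    refine ENNReal.ofReal_le_ofReal ?_
    calc ‖G p‖ * (cd * nb p) = cd * (‖G p‖ * nb p) := by ring
      _ ≤ cd * (1 / 2 * (‖G p‖ ^ 2 / (8 * Real.pi ^ 2 * ‖p‖ ^ 2) + 8 * Real.pi ^ 2 * ‖p‖ ^ 2 * (Nb (-p)).toReal)) :=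
          mul_le_mul_of_nonneg_left h1 hcd0
      _ = _ := by ring
  have hae : ∀ᵐ p ∂(volume : Measure Space), ‖‖G p‖ * (cd * nb p)‖ₑ ≤
      ENNReal.ofReal (cd / 2) * (ENNReal.ofReal (‖G p‖ ^ 2 / (8 * Real.pi ^ 2 * ‖p‖ ^ 2)) +
        ENNReal.ofReal (8 * Real.pi ^ 2 * ‖p‖ ^ 2) * Nb (-p)) := by
    filter_upwards [ae_ne_zero_space] with p hp using hpt p hp
  refine lt_of_le_of_lt (lintegral_mono_ae hae) ?_
  have hwm : Measurable fun p : Space => ENNReal.ofReal (8 * Real.pi ^ 2 * ‖p‖ ^ 2) :=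
    ENNReal.measurable_ofReal.comp (by fun_prop)
  have hGm2 : Measurable fun p : Space => ENNReal.ofReal (‖G p‖ ^ 2 / (8 * Real.pi ^ 2 * ‖p‖ ^ 2)) :=
    ENNReal.measurable_ofReal.comp ((hGc.norm.measurable.pow_const _).div (by fun_prop))
  have hsm : Measurable fun p : Space => ENNReal.ofReal (‖G p‖ ^ 2 / (8 * Real.pi ^ 2 * ‖p‖ ^ 2)) +
      ENNReal.ofReal (8 * Real.pi ^ 2 * ‖p‖ ^ 2) * Nb (-p) := hGm2.add (hwm.mul hNbm')
  rw [lintegral_const_mul _ hsm, lintegral_add_left hGm2]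
  refine ENNReal.mul_lt_top ENNReal.ofReal_lt_top (ENNReal.add_lt_top.2 ⟨hGcoul.lt_top, ?_⟩)
  -- `∫ 8π²p² ‖b_{-p}Φ‖² dp = ∫ 8π²p² ‖b_pΦ‖² dp ≤ 2∫τ‖b_pΦ‖² + 2σ²∫‖b_pΦ‖² < ∞`
  have hneg : ∫⁻ p : Space, ENNReal.ofReal (8 * Real.pi ^ 2 * ‖p‖ ^ 2) * Nb (-p) =
      ∫⁻ p : Space, ENNReal.ofReal (8 * Real.pi ^ 2 * ‖p‖ ^ 2) * Nb p := by
    have h := (Measure.measurePreserving_neg (volume : Measure Space)).lintegral_comp (hwm.mul hNbm)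
    refine Eq.trans (lintegral_congr fun p => ?_) h
    show _ = ENNReal.ofReal (8 * Real.pi ^ 2 * ‖-p‖ ^ 2) * Nb (-p)
    rw [norm_neg]
  rw [hneg]
  have hτm : Measurable fun p : Space => ENNReal.ofReal (4 * Real.pi ^ 2 * ‖p‖ ^ 2 - σ ^ 2) :=
    ENNReal.measurable_ofReal.comp (by fun_prop)
  have hA : Measurable fun p : Space => 2 * (ENNReal.ofReal (4 * Real.pi ^ 2 * ‖p‖ ^ 2 - σ ^ 2) * Nb p) :=
    (hτm.mul hNbm).const_mul 2
  have hB : Measurable fun p : Space => ENNReal.ofReal (σ ^ 2) * Nb p := hNbm.const_mul _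
  have hC : Measurable fun p : Space => ENNReal.ofReal (4 * Real.pi ^ 2 * ‖p‖ ^ 2 - σ ^ 2) * Nb p := hτm.mul hNbm
  have hpt2 : ∀ p : Space, ENNReal.ofReal (8 * Real.pi ^ 2 * ‖p‖ ^ 2) * Nb p ≤
      2 * (ENNReal.ofReal (4 * Real.pi ^ 2 * ‖p‖ ^ 2 - σ ^ 2) * Nb p) + 2 * (ENNReal.ofReal (σ ^ 2) * Nb p) := fun p =>
    calc ENNReal.ofReal (8 * Real.pi ^ 2 * ‖p‖ ^ 2) * Nb p
        ≤ (2 * ENNReal.ofReal (4 * Real.pi ^ 2 * ‖p‖ ^ 2 - σ ^ 2) + 2 * ENNReal.ofReal (σ ^ 2)) * Nb p :=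
          mul_le_mul_left (ofReal_weight_le σ p) _
      _ = _ := by ring
  calc ∫⁻ p : Space, ENNReal.ofReal (8 * Real.pi ^ 2 * ‖p‖ ^ 2) * Nb p
      ≤ ∫⁻ p : Space, 2 * (ENNReal.ofReal (4 * Real.pi ^ 2 * ‖p‖ ^ 2 - σ ^ 2) * Nb p) + 2 * (ENNReal.ofReal (σ ^ 2) * Nb p) :=
        lintegral_mono hpt2
    _ = 2 * (∫⁻ p : Space, ENNReal.ofReal (4 * Real.pi ^ 2 * ‖p‖ ^ 2 - σ ^ 2) * Nb p) +
          2 * (ENNReal.ofReal (σ ^ 2) * ∫⁻ p : Space, Nb p) := by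
        rw [lintegral_add_left hA, lintegral_const_mul 2 hC, lintegral_const_mul 2 hB,
          lintegral_const_mul _ hNbm]
    _ < ⊤ := by
        refine ENNReal.add_lt_top.2 ⟨ENNReal.mul_lt_top (by simp) hτ.lt_top, ?_⟩
        exact ENNReal.mul_lt_top (by simp) (ENNReal.mul_lt_top ENNReal.ofReal_lt_top hN0.lt_top)

end Domination

/-! ### The assembly: (2.29) on bounded states -/

section Assembly

open Filter Topology ContinuousLinearMap
open scoped Convolution

/-- **Fournais 2020, (2.29), proved on bounded states**:
`⟨Φ, A₂Φ⟩ = ∫ Ŵ₁(p) Re⟨b_p†Φ, b_{-p}Φ⟩ dp` with an absolutely convergent momentum integral, for every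
bounded measurable `Φ` on `Λ(u)ⁿ` of finite kinetic form — the printed "direct calculation gives
`A₂ = ½(2π)⁻³∫Ŵ₁(k)(b_k†b_{-k}† + b_kb_{-k})dk`" made rigorous: (I) `⟨b_p†Φ,b_{-p}Φ⟩` in first
quantisation (`PeriodicBoseGasPairingMomentum.lean`); (II) Fubini and Fourier inversion for a
regularised potential; (III) mollification `W₁ ← ψ_k ⋆ W₁` (`W₁ ∈ L¹` only): on the momentum side
`𝓕(ψ_k⋆W₁) = ψ̂_kŴ₁ → Ŵ₁` dominatedly (Cauchy–Schwarz with (2.28)-type bounds, (2.30), (2.32) and the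
finite Coulomb energy (2.42) of `W₁`), on the position side by the `L¹`-continuity of
`W ↦ ⟨Φ, A₂[W]Φ⟩` for bounded `Φ`. [cite: Fournais2020, (2.29), (2.24), (2.30)–(2.32), (2.42)] -/
theorem Fournais2020_eq229_bdd_holds : Fournais2020_eq229_bdd := by
  intro v hv hvi ω hω χ hχ C R hC hχC hR0 hR ℓ s b hℓ hs hb hsmall n u Φ hΦm hΦb hN2 hkin
  cases n with
  | zero =>
    refine ⟨?_, ?_⟩
    · simp only [pairingRe_zero, mul_zero]; exact integrable_zero _ _ _
    · simp only [pairingRe_zero, mul_zero, integral_zero, a2Form, Finset.univ_eq_empty, Finset.sum_empty]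
  | succ m =>
  obtain ⟨M, hM⟩ := hΦb
  obtain ⟨Cχ, hCχ⟩ := hχ.exists_bound
  have hχc : Continuous χ := hχ.continuous
  have hπ := Real.pi_pos
  -- the potential `W₁` and its Fourier transform
  obtain ⟨W₁r, hW₁r⟩ : ∃ g : Space → ℝ, g = fun x => (bigW₁ v ω χ ℓ x).toReal := ⟨_, rfl⟩
  have hW₁ri : Integrable W₁r := by
    rw [hW₁r]; exact (integral_toReal_bigW₁_le_sharp hv.1 hR hvi hℓ hC hχ hχC hsmall hω).1
  have hW₁rm : Measurable W₁r := by
    rw [hW₁r]; exact (measurable_bigW₁ hv.1 hω.measurable hχ ℓ).ennreal_toReal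
  have hW₁re : ∀ x, W₁r (-x) = W₁r x := fun x => by simp only [hW₁r, bigW₁_neg v hω hχ ℓ]
  have heqW : (fun x : Space => ((bigW₁ v ω χ ℓ x).toReal : ℂ)) = fun x => (W₁r x : ℂ) := by rw [hW₁r]
  rw [heqW]
  set W₁ : Space → ℂ := fun x => (W₁r x : ℂ) with hW₁
  have hW₁i : Integrable W₁ := hW₁ri.ofReal
  have hFW₁c : Continuous (𝓕 W₁) := Literature.Analysis.FluidPDE.FourierNS.continuous_fourierIntegral hW₁i
  have hFW₁im : ∀ p, (𝓕 W₁ p).im = 0 := im_fourier_ofReal_eq_zero hW₁re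
  -- the pairing `Z(p) = ⟨b_p†Φ, b_{-p}Φ⟩`
  set Z : Space → ℂ := fun p => ∫ X in boxConfig (m + 1) ℓ u, conj (bDagVec χ ℓ u p Φ X) * bVec χ ℓ u (-p) Φ X with hZ
  have hZm : Measurable Z := measurable_integral_conj_bDagVec_mul_bVec hχ ℓ u hΦm
  have hpair : ∀ p, pairingRe χ ℓ u p Φ = (Z p).re := fun p => rfl
  have hΦ2 : MemLp Φ 2 (volume.restrict (boxConfig (m + 1) ℓ u)) := memLp_two_of_bound hΦm hM
  -- finiteness of `n₊`, of the kinetic excitation form, (2.30), (2.32) and the Coulomb energy (2.42)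
  have hNPt : nPlusBoxN ℓ u Φ ≠ ⊤ := by
    intro htop
    have h := kinExcForm_add_le_kinBoxN χ ℓ s b u Φ
    rw [htop, ENNReal.mul_top (by simpa using div_pos hb (pow_pos hℓ 2)), add_top, top_le_iff] at h
    exact hkin h
  obtain ⟨hTt, -⟩ := toReal_kinExcForm_add_le χ ℓ s (b := b) (by positivity) u Φ hkin hNPt
  have h230 := lintegral_tau_normSq_bVec_le hχc hℓ s u hΦm (Φ := Φ)
  have h232 := lintegral_lintegral_normSq_bVec_le hχc hCχ hℓ u hΦm (Φ := Φ)
  have hℓ3 : (ENNReal.ofReal ℓ ^ 3)⁻¹ ≠ ⊤ := ENNReal.inv_ne_top.2 (pow_ne_zero _ (by rwa [Ne, ENNReal.ofReal_eq_zero, not_le]))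
  have hτ : (∫⁻ p : Space, ENNReal.ofReal (4 * Real.pi ^ 2 * ‖p‖ ^ 2 - (s * ℓ)⁻¹ ^ 2) *
      ∫⁻ X in boxConfig (m + 1) ℓ u, ((‖bVec χ ℓ u p Φ X‖₊ : ℝ≥0∞)) ^ 2) ≠ ⊤ :=
    ne_top_of_le_ne_top (ENNReal.mul_ne_top (ENNReal.mul_ne_top (ENNReal.natCast_ne_top _) hℓ3) hTt) h230
  have hN0 : (∫⁻ p : Space, ∫⁻ X in boxConfig (m + 1) ℓ u, ((‖bVec χ ℓ u p Φ X‖₊ : ℝ≥0∞)) ^ 2) ≠ ⊤ :=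
    ne_top_of_le_ne_top (ENNReal.mul_ne_top (ENNReal.mul_ne_top (ENNReal.mul_ne_top ENNReal.ofReal_ne_top
      (ENNReal.natCast_ne_top _)) hℓ3) hNPt) h232
  have hsLt : scatteringLength v ≠ ⊤ := by
    refine scatteringLength_ne_top ?_
    rw [lintegral_const_mul' _ _ (ENNReal.inv_ne_top.2 two_ne_zero)]
    exact ENNReal.mul_ne_top (ENNReal.inv_ne_top.2 two_ne_zero) hvi
  have hgΩt : gOmegaIntegral v ω ≠ ⊤ :=
    ne_top_of_le_ne_top (ENNReal.mul_ne_top ENNReal.ofReal_ne_top hsLt) (gOmegaIntegral_le hω)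
  have hcoul : (∫⁻ p : Space, ENNReal.ofReal (‖𝓕 W₁ p‖ ^ 2 / (8 * Real.pi ^ 2 * ‖p‖ ^ 2))) ≠ ⊤ := by
    have h := Fournais2020_eq242_holds v hv hvi ω hω χ hχ C R hC hχC hR0 hR ℓ hℓ hsmall
    rw [heqW] at h
    exact ne_top_of_le_ne_top (ENNReal.mul_ne_top ENNReal.ofReal_ne_top hgΩt) h
  -- the dominating function and the absolute convergence
  obtain ⟨bound, hbi, hble⟩ := exists_integrable_bound_pairing hχ hCχ hℓ u hΦm hN2 hNPt hτ hN0 hFW₁c hcoul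
  have hI : Integrable fun p => 𝓕 W₁ p * Z p :=
    hbi.mono' (hFW₁c.aestronglyMeasurable.mul hZm.aestronglyMeasurable)
      (Eventually.of_forall fun p => by rw [norm_mul]; exact hble p)
  -- mollification of `W₁`
  obtain ⟨φ, hφ, -⟩ := Literature.Analysis.FunctionSpaces.exists_contDiffBump_seq (E := Space)
  set f : ℕ → Space → ℝ := fun k => (φ k).normed volume ⋆[lsmul ℝ ℝ, volume] W₁r with hf
  have hfp := fun k => normed_convolution_props (φ k) hW₁ri hW₁re
  -- the position-side pair sum
  set A : (Space → ℝ) → ℂ := fun g => ∑ i : Fin (m + 1), ∑ j : Fin (m + 1) with j ≠ i, ∫ X in boxConfig (m + 1) ℓ u,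
    conj (nbodyP ℓ u i (nbodyP ℓ u j Φ) X) * ((locFun χ ℓ u (X i) * g (X i - X j) * locFun χ ℓ u (X j) : ℝ) : ℂ) *
      nbodyQ ℓ u j (nbodyQ ℓ u i Φ) X with hA
  -- Step II for every `k`
  have hk : ∀ k, ∫ p, 𝓕 (fun x => (f k x : ℂ)) p * Z p = A (f k) := fun k =>
    integral_fourier_mul_pairing (hfp k).1 (hfp k).2.1 (hfp k).2.2.2.2 (hfp k).2.2.1 hχ hℓ u hΦm hΦ2
  -- the momentum side: dominated convergence
  have hlim1 : Tendsto (fun k => ∫ p, 𝓕 (fun x => (f k x : ℂ)) p * Z p) atTop (𝓝 (∫ p, 𝓕 W₁ p * Z p)) := by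
    have hfour : ∀ k p, 𝓕 (fun x => (f k x : ℂ)) p = 𝓕 (fun x => (((φ k).normed volume x : ℝ) : ℂ)) p * 𝓕 W₁ p :=
      fun k p => (hfp k).2.2.2.1 p
    refine tendsto_integral_of_dominated_convergence bound (fun k => ?_) hbi (fun k => Eventually.of_forall fun p => ?_)
      (Eventually.of_forall fun p => ?_)
    · exact (Literature.Analysis.FluidPDE.FourierNS.continuous_fourierIntegral (hfp k).2.1.ofReal).aestronglyMeasurable.mul
        hZm.aestronglyMeasurable
    · rw [hfour, norm_mul, norm_mul, mul_assoc]
      refine (mul_le_of_le_one_left (by positivity) ((fourier_normed_props (φ k)).2 p)).trans (hble p)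
    · simp_rw [hfour, mul_assoc]
      have h := (tendsto_fourier_normed hφ p).mul (tendsto_const_nhds (x := 𝓕 W₁ p * Z p))
      rwa [one_mul] at h
  -- the position side: `L¹`-continuity
  have hlim2 : Tendsto (fun k => A (f k)) atTop (𝓝 (A W₁r)) := by
    have hM0 : 0 ≤ M := (norm_nonneg _).trans (hM 0)
    set K : ℝ := M * Cχ ^ 2 * (4 * M) * (ℓ ^ 3) ^ m with hK
    have hterm : ∀ k, ‖A (f k) - A W₁r‖ ≤ ((m + 1 : ℕ) : ℝ) * ((m + 1 : ℕ) * (K * ∫ z, ‖f k z - W₁r z‖)) := by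
      intro k
      simp only [hA]
      rw [← Finset.sum_sub_distrib]
      refine (norm_sum_le _ _).trans ?_
      have h1 : ∀ i ∈ (Finset.univ : Finset (Fin (m + 1))),
          ‖(∑ j : Fin (m + 1) with j ≠ i, ∫ X in boxConfig (m + 1) ℓ u,
              conj (nbodyP ℓ u i (nbodyP ℓ u j Φ) X) *
                ((locFun χ ℓ u (X i) * f k (X i - X j) * locFun χ ℓ u (X j) : ℝ) : ℂ) * nbodyQ ℓ u j (nbodyQ ℓ u i Φ) X) -
            ∑ j : Fin (m + 1) with j ≠ i, ∫ X in boxConfig (m + 1) ℓ u,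
              conj (nbodyP ℓ u i (nbodyP ℓ u j Φ) X) *
                ((locFun χ ℓ u (X i) * W₁r (X i - X j) * locFun χ ℓ u (X j) : ℝ) : ℂ) * nbodyQ ℓ u j (nbodyQ ℓ u i Φ) X‖ ≤
          (m + 1 : ℕ) * (K * ∫ z, ‖f k z - W₁r z‖) := by
        intro i _
        rw [← Finset.sum_sub_distrib]
        refine (norm_sum_le _ _).trans ?_
        have h2 : ∀ j ∈ (Finset.univ.filter fun j : Fin (m + 1) => j ≠ i),
            ‖(∫ X in boxConfig (m + 1) ℓ u, conj (nbodyP ℓ u i (nbodyP ℓ u j Φ) X) *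
                ((locFun χ ℓ u (X i) * f k (X i - X j) * locFun χ ℓ u (X j) : ℝ) : ℂ) * nbodyQ ℓ u j (nbodyQ ℓ u i Φ) X) -
              ∫ X in boxConfig (m + 1) ℓ u, conj (nbodyP ℓ u i (nbodyP ℓ u j Φ) X) *
                ((locFun χ ℓ u (X i) * W₁r (X i - X j) * locFun χ ℓ u (X j) : ℝ) : ℂ) * nbodyQ ℓ u j (nbodyQ ℓ u i Φ) X‖ ≤
            K * ∫ z, ‖f k z - W₁r z‖ := by
          intro j hj
          have hji : j ≠ i := (Finset.mem_filter.1 hj).2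
          exact norm_pairTerm_sub_le hχ hCχ hℓ hji.symm (hfp k).1.measurable (hfp k).2.1 hW₁rm hW₁ri hΦm hM
        refine (Finset.sum_le_sum h2).trans ?_
        rw [Finset.sum_const, nsmul_eq_mul]
        refine mul_le_mul_of_nonneg_right ?_ (mul_nonneg (by positivity) (integral_nonneg fun _ => norm_nonneg _))
        exact_mod_cast (Finset.card_filter_le _ _).trans (by simp)
      refine (Finset.sum_le_sum h1).trans ?_
      rw [Finset.sum_const, Finset.card_univ, Fintype.card_fin, nsmul_eq_mul]
    -- `‖f_k - W₁‖₁ → 0`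
    have hL1 : Tendsto (fun k => ∫ z, ‖f k z - W₁r z‖) atTop (𝓝 0) := by
      have h := Literature.Analysis.FunctionSpaces.tendsto_eLpNorm_normed_convolution_sub_self (μ := (volume : Measure Space))
        hφ le_rfl ENNReal.one_ne_top (memLp_one_iff_integrable.2 hW₁ri)
      have h' := (ENNReal.tendsto_toReal ENNReal.zero_ne_top).comp h
      rw [ENNReal.toReal_zero] at h'
      refine h'.congr fun k => ?_
      rw [Function.comp_apply, eLpNorm_one_eq_lintegral_enorm,
        ← integral_norm_eq_lintegral_enorm (((hfp k).2.1.sub hW₁ri).aestronglyMeasurable)]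
      rfl
    rw [tendsto_iff_norm_sub_tendsto_zero]
    refine squeeze_zero (fun k => norm_nonneg _) hterm ?_
    have h := (hL1.const_mul K).const_mul ((m + 1 : ℕ) : ℝ) |>.const_mul ((m + 1 : ℕ) : ℝ)
    simpa using h
  -- the two limits agree
  have hEq : ∫ p, 𝓕 W₁ p * Z p = A W₁r := by
    refine tendsto_nhds_unique hlim1 ?_
    simpa only [hk] using hlim2
  -- conclusion
  have hre : ∀ p, (𝓕 W₁ p).re * pairingRe χ ℓ u p Φ = (𝓕 W₁ p * Z p).re := fun p => by
    rw [hpair, Complex.mul_re, hFW₁im, zero_mul, sub_zero]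
  refine ⟨(hI.re).congr (Eventually.of_forall fun p => ?_), ?_⟩
  · simp only [RCLike.re_to_complex, hre]
  · have h1 : a2Form v ω χ ℓ u Φ = (A W₁r).re := by
      rw [a2Form_eq_re_sum v ω hχ ℓ u Φ]
      simp only [hA, hW₁r]
    rw [h1, ← hEq]
    have h2 := integral_re hI
    simp only [RCLike.re_to_complex] at h2
    rw [← h2]
    exact integral_congr_ae (Eventually.of_forall fun p => (hre p).symm)

end Assembly

end Literature.MathematicalPhysics.QuantumManyBody.BoseGas

end
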